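import Literature.Analysis.FluidPDE.PassiveScalarPairingMollified
import Literature.Analysis.FluidPDE.PassiveScalarEnergyL1Sobolev
import Literature.Analysis.FluidPDE.PassiveScalarForcedSpectralMeasurability
import HarnessLib

/-!
# The pairing inequality between a sourced weak passive scalar and a bounded later release

Analysis/FluidPDE proof-support file (everything proved). Let `a` be a weak solution of
`∂ₜa + u·∇a = κΔa + f` on `T^d × [0,T)` with datum `a₀ ∈ L²` and smooth steady source `f`, over a
drift with `∫₀ᵀ ‖∇u(t)‖_{L²} dt < ∞`; let `σ ∈ [0,T)` and let `b` be a BOUNDED weak solution of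
the homogeneous equation driven by `u(σ + ·)` on `[0,T_b)` with smooth datum `g` (a release of
`g` at time `σ`). Then for a.e. `τ ∈ (0, min T_b (T-σ))` (**`ae_pairing_bound`**)

  `| ∫ a(σ+τ) b(τ) - P_g(σ) - ∫_{(0,τ]} ∫ b(τ') f dτ' |
      ≤ 2 (eScalarDissipation κ a σ (σ+τ))^{1/2} (eScalarDissipation κ b 0 τ)^{1/2}`,

where `P_g(σ)` is the trace of `t ↦ ∫ a(t) g` at `σ` (`PassiveScalarForcedTrace`): formally
`d/dt (a, b) = -2κ (∇a, ∇b) + (f, b)`, the transport terms cancelling by incompressibility.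
Proof: the mollified identity of `PassiveScalarPairingMollified` along `kₙ → δ₀`; the flux
algebra `G = r - ⟪u, ∇(a ⋆ k)⟫ + κΔ(a ⋆ k)` (`PassiveScalarRenormalizedSlice`) turns its time
integrand into `∫ b r + 2κ ∫ b Δ(a ⋆ kₙ) + ∫ b (f ⋆ kₙ)`; the DiPerna–Lions commutator `r → 0` in
`L¹_{t,x}` (`PassiveScalarCommutatorSobolev`) is paired with the bounded `b`, the diffusion
pairing is bounded spectrally (`enorm_integral_mul_laplacian_le`,
`eScalarGradNormSq_convolution_le`) uniformly in `n`, and `P_{g ⋆ kₙ}(σ) → P_g(σ)`.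
These are the inputs (P1) (`a = θ` sourced, `b` a release of the source profile) and (P2)
(`a`, `b` two releases) of the age-decoupling argument (`FluidPDE/AgeDecouplingInequality`).

## References

* R. J. DiPerna, P.-L. Lions, Invent. Math. 98 (1989), 511–547, §II.1, §II.3, Thm. II.3. [`DiPernaLions1989`]
* P. Bonicatto, G. Ciampa, G. Crippa, J. Evol. Equ. 24 (2024), Thm. 3.3. [`BonicattoCiampaCrippa2023`]
-/

noncomputable section

open MeasureTheory TopologicalSpace Set Function Filter Topology Metric ContinuousLinearMap
  UnitAddTorus
open scoped ENNReal NNReal Convolution ContDiff InnerProductSpace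

namespace Literature.Analysis.FluidPDE

namespace Torus

variable {d : Type*} [Fintype d]

/-! ## Time translation of (a.e.-)measurability -/

omit [Fintype d] in
/-- A.e.-measurability on `(0,T)` passes to the time translate on `(0,T')` when
`(σ, σ + T') ⊆ (0,T)`. [folklore] -/
theorem aemeasurable_comp_add_left {F : ℝ → ℝ≥0∞} {T σ T' : ℝ}
    (h : AEMeasurable F ((volume : Measure ℝ).restrict (Ioo 0 T))) (hσ : 0 ≤ σ) (hT' : σ + T' ≤ T) :
    AEMeasurable (fun t => F (σ + t)) ((volume : Measure ℝ).restrict (Ioo 0 T')) := by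
  have hmp : MeasurePreserving (fun t : ℝ => σ + t) ((volume : Measure ℝ).restrict (Ioo 0 T'))
      ((volume : Measure ℝ).restrict (Ioo σ (σ + T'))) := by
    have h1 : MeasurePreserving (fun t : ℝ => σ + t) volume volume := measurePreserving_add_left volume σ
    have h2 := h1.restrict_preimage (measurableSet_Ioo (a := σ) (b := σ + T'))
    have hpre : (fun t : ℝ => σ + t) ⁻¹' Ioo σ (σ + T') = Ioo 0 T' := by ext t; simp
    rwa [hpre] at h2
  have hle : (volume : Measure ℝ).restrict (Ioo σ (σ + T')) ≤ (volume : Measure ℝ).restrict (Ioo 0 T) :=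
    Measure.restrict_mono_set _ (Ioo_subset_Ioo hσ hT')
  exact (h.mono_measure hle).comp_quasiMeasurePreserving hmp.quasiMeasurePreserving

omit [Fintype d] in
/-- A.e.-strong measurability on `(0,T)` passes to the time translate on `(0,T')` when
`(σ, σ + T') ⊆ (0,T)`. [folklore] -/
theorem aestronglyMeasurable_comp_add_left {E : Type*} [TopologicalSpace E] {F : ℝ → E} {T σ T' : ℝ}
    (h : AEStronglyMeasurable F ((volume : Measure ℝ).restrict (Ioo 0 T))) (hσ : 0 ≤ σ) (hT' : σ + T' ≤ T) :
    AEStronglyMeasurable (fun t => F (σ + t)) ((volume : Measure ℝ).restrict (Ioo 0 T')) := by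
  have hmp : MeasurePreserving (fun t : ℝ => σ + t) ((volume : Measure ℝ).restrict (Ioo 0 T'))
      ((volume : Measure ℝ).restrict (Ioo σ (σ + T'))) := by
    have h1 : MeasurePreserving (fun t : ℝ => σ + t) volume volume := measurePreserving_add_left volume σ
    have h2 := h1.restrict_preimage (measurableSet_Ioo (a := σ) (b := σ + T'))
    have hpre : (fun t : ℝ => σ + t) ⁻¹' Ioo σ (σ + T') = Ioo 0 T' := by ext t; simp
    rwa [hpre] at h2
  have hle : (volume : Measure ℝ).restrict (Ioo σ (σ + T')) ≤ (volume : Measure ℝ).restrict (Ioo 0 T) :=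
    Measure.restrict_mono_set _ (Ioo_subset_Ioo hσ hT')
  exact (h.mono_measure hle).comp_measurePreserving hmp

omit [Fintype d] in
/-- A lower integral over a translated subwindow is at most the full one. [folklore] -/
theorem setLIntegral_comp_add_left_le {F : ℝ → ℝ≥0∞} {T σ T' : ℝ} (hσ : 0 ≤ σ) (hT' : σ + T' ≤ T) :
    ∫⁻ t in Ioo 0 T', F (σ + t) ≤ ∫⁻ t in Ioo 0 T, F t := by
  have e : ∫⁻ t in Ioo 0 T', F (σ + t) = ∫⁻ t in Ioo (0 + σ) (T' + σ), F t := by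
    rw [← setLIntegral_Ioo_comp_add_right F 0 T' σ]
    exact lintegral_congr fun t => by rw [add_comm]
  rw [e]
  exact lintegral_mono_set (Ioo_subset_Ioo (by linarith) (by linarith))

namespace IsWeakScalarTransportForcedOn

variable {T κ : ℝ} {u : ℝ → UnitAddTorus d → EuclideanSpace ℝ d}

/-! ## The pairing inequality -/

variable {f : UnitAddTorus d → ℝ} {a₀ : UnitAddTorus d → ℝ} {a : ℝ → UnitAddTorus d → ℝ}

/-- **The pairing inequality between a steadily sourced weak passive scalar and a bounded
release of a smooth profile at a later time** (DiPerna–Lions pairing at Sobolev level, with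
viscosity): for `κ ≥ 0`, a weak solution `a` of `∂ₜa + u·∇a = κΔa + f` with `L²` datum over a
drift with `∫₀ᵀ ‖∇u‖_{L²} < ∞`, `σ ∈ [0,T)`, and a bounded weak solution `b` of the homogeneous
equation driven by `u(σ+·)` with smooth datum `g`, for a.e. `τ ∈ (0, min T_b (T-σ))`:
`|∫ a(σ+τ) b(τ) - P_g(σ) - ∫_{(0,τ]} ∫ b(τ') f| ≤ 2 D_a(σ, σ+τ)^{1/2} D_b(0, τ)^{1/2}` with the
cumulative dissipations `D = eScalarDissipation κ`, and `P_g(σ)` the trace of `t ↦ ∫ a(t) g` at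
`σ`. [cite: DiPernaLions1989, §II.3 Thm. II.3] -/
theorem ae_pairing_bound (hκ : 0 ≤ κ) (ha : IsWeakScalarTransportForcedOn T κ u (fun _ => f) a₀ a)
    (ha₀ : MemLp a₀ 2 volume) (hf : FunctionSpaces.Torus.IsSmooth f)
    (hG : ∫⁻ t in Ioo 0 T, FunctionSpaces.Torus.eGradNormSq (u t) ^ (1 / 2 : ℝ) < ⊤)
    {σ Tb : ℝ} (hσ : 0 ≤ σ) (hσT : σ < T) (hTb : 0 < Tb)
    {g : UnitAddTorus d → ℝ} (hg : FunctionSpaces.Torus.IsSmooth g) {b : ℝ → UnitAddTorus d → ℝ}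
    (hb : IsWeakScalarTransportOn Tb κ (fun τ => u (σ + τ)) g b)
    {B : ℝ} (hbB : ∀ᵐ τ ∂(volume.restrict (Ioo 0 Tb)), ∀ᵐ x ∂(volume : Measure (UnitAddTorus d)), |b τ x| ≤ B) :
    ∀ᵐ τ ∂(volume.restrict (Ioo 0 (min Tb (T - σ)))),
      ENNReal.ofReal |(∫ x, a (σ + τ) x * b τ x) -
          ((∫ y, a₀ y * g y) + ∫ r in Ioc 0 σ, ((∫ y, a r y *
            (⟪u r y, FunctionSpaces.Torus.gradient g y⟫_ℝ + κ * FunctionSpaces.Torus.laplacian g y)) +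
            ∫ y, f y * g y)) -
          ∫ τ' in Ioc 0 τ, ∫ y, b τ' y * f y| ≤
        2 * eScalarDissipation κ a σ (σ + τ) ^ (1 / 2 : ℝ) * eScalarDissipation κ b 0 τ ^ (1 / 2 : ℝ) := by
  classical
  haveI : (volume : Measure (UnitAddTorus d)).IsNegInvariant := Pi.isNegInvariant_volume
  -- ### horizons and measures
  set T'' : ℝ := min Tb (T - σ) with hT''
  have hT''0 : 0 < T'' := lt_min hTb (by linarith)
  have hT''b : T'' ≤ Tb := min_le_left _ _
  have hσT'' : σ + T'' ≤ T := by have := min_le_right Tb (T - σ); linarith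
  set μa : Measure ℝ := (volume : Measure ℝ).restrict (Ioo 0 T) with hμa
  set μb : Measure ℝ := (volume : Measure ℝ).restrict (Ioo 0 Tb) with hμb
  set μ'' : Measure ℝ := (volume : Measure ℝ).restrict (Ioo 0 T'') with hμ''
  have hsub''b : Ioo 0 T'' ⊆ Ioo 0 Tb := Ioo_subset_Ioo le_rfl hT''b
  have hle''b : μ'' ≤ μb := Measure.restrict_mono_set _ hsub''b
  haveI : IsFiniteMeasure μa := by rw [hμa]; infer_instance
  haveI : IsFiniteMeasure μ'' := by rw [hμ'']; infer_instance
  -- ### kernels (for `a`)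
  obtain ⟨hε, hε', hε0⟩ := molRadius_spec
  set ε : ℕ → ℝ := fun n => 1 / (4 * ((n : ℝ) + 1)) with hε_def
  set kk : ℕ → UnitAddTorus d → ℝ := fun n => FunctionSpaces.Torus.kernel (d := d) (ε n) with hkk
  have hkS : ∀ n, FunctionSpaces.Torus.IsSmooth (kk n) := fun n => FunctionSpaces.Torus.isSmooth_kernel (hε n) (hε' n)
  have hk0 : ∀ n y, 0 ≤ kk n y := fun n y => FunctionSpaces.Torus.kernel_nonneg (hε n).le y
  have hk1 : ∀ n, ∫ y, kk n y = 1 := fun n => FunctionSpaces.Torus.integral_kernel (hε n) (hε' n)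
  have hks : ∀ n, support (kk n) ⊆ ball 0 (ε n) := fun n => FunctionSpaces.Torus.support_kernel_subset (hε n)
  have hkke : ∀ n z, kk n (-z) = kk n z := fun n z => FunctionSpaces.Torus.kernel_neg (hε n) (hε' n) z
  have hconv : ∀ (δ φ : UnitAddTorus d → ℝ) (x : UnitAddTorus d), (δ ⋆ φ) x = ∫ y, δ y * φ (x - y) :=
    fun δ φ x => by simp only [convolution_lsmul, smul_eq_mul]
  -- ### the source and its mollifications
  obtain ⟨Cf, hCf⟩ := FunctionSpaces.Torus.exists_forall_norm_le_of_continuous hf.continuous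
  have hCf0 : 0 ≤ Cf := (norm_nonneg _).trans (hCf 0)
  set Sf : ℕ → UnitAddTorus d → ℝ := fun n x => ∫ y, f y * kk n (x - y) with hSf_def
  have hSf_conv : ∀ n, Sf n = f ⋆ kk n := fun n => by
    funext x; simp only [hSf_def, convolution_lsmul, smul_eq_mul]
  have hSf_cont : ∀ n, Continuous (Sf n) := fun n => by
    rw [hSf_conv n]; exact FunctionSpaces.Torus.continuous_convolution hf.continuous.integrable_unitAddTorus (hkS n).continuous
  have hSf_le : ∀ n x, |Sf n x| ≤ Cf := fun n x => by
    rw [hSf_conv n]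
    exact abs_convolution_le_of_forall_abs_le hf.continuous.aestronglyMeasurable
      (fun y => by rw [← Real.norm_eq_abs]; exact hCf y) (hk0 n) (hk1 n) x
  have hSf_pt : ∀ x, Tendsto (fun n => Sf n x) atTop (𝓝 (f x)) :=
    tendsto_apply_of_eventually_forall_norm_sub_le fun η hη => by
      filter_upwards [eventually_forall_abs_convolution_sub_le hf.continuous hk0 hk1 hks hε0 hη] with n hn x
      rw [Real.norm_eq_abs, hSf_conv n]; exact hn x
  -- ### the `a`-side slice facts
  obtain ⟨Ca, hCa⟩ := ha.exists_eLpNorm_le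
  have ha₀i : Integrable a₀ volume := ha₀.integrable one_le_two
  have hGm : AEMeasurable (fun t => FunctionSpaces.Torus.eGradNormSq (u t)) μa :=
    aemeasurable_eGradNormSq_slice ha.aestronglyMeasurable_uncurry_velocity
  -- the commutator size
  set ρ : ℕ → ℝ → ℝ≥0∞ := fun n r => ∫⁻ x, ‖∫ y, a r y * ⟪u r x - u r y,
    FunctionSpaces.Torus.gradient (kk n) (x - y)⟫_ℝ‖ₑ with hρ_def
  have hρm : ∀ n, AEMeasurable (ρ n) μa := fun n => ha.aemeasurable_lintegral_enorm_comm (hkS n)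
  set Kρ : ℝ → ℝ≥0∞ := fun r => (Ca : ℝ≥0∞) * FunctionSpaces.Torus.eGradNormSq (u r) ^ (1 / 2 : ℝ) *
    ENNReal.ofReal (FunctionSpaces.Torus.gradProfileMass d) with hKρ
  have hKρm : AEMeasurable Kρ μa := ((hGm.pow_const _).const_mul _).mul_const _
  have hKρt : ∫⁻ r, Kρ r ∂μa ≠ ⊤ := by
    rw [hKρ, lintegral_mul_const'' _ ((hGm.pow_const _).const_mul _), lintegral_const_mul'' _ (hGm.pow_const _)]
    exact ENNReal.mul_ne_top (ENNReal.mul_ne_top ENNReal.coe_ne_top hG.ne) ENNReal.ofReal_ne_top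
  have hKρfin : ∀ᵐ r ∂μa, Kρ r < ⊤ := ae_lt_top' hKρm hKρt
  have hgoodA : ∀ᵐ r ∂μa, (Integrable (a r) volume ∧ AEStronglyMeasurable (u r) volume ∧
      Integrable (fun y => ‖u r y‖ * a r y) volume) ∧ FunctionSpaces.Torus.IsWeaklyDivFree (u r) ∧
      MemLp (a r) 2 volume ∧ eLpNorm (a r) 2 volume ≤ Ca ∧ Integrable (u r) volume ∧ MemLp (u r) 2 volume ∧
      FunctionSpaces.Torus.eGradNormSq (u r) < ⊤ ∧ (∀ n, ρ n r ≤ Kρ r) ∧ Kρ r < ⊤ ∧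
      Tendsto (fun n => eLpNorm (a r ⋆ kk n - a r) 2 volume) atTop (𝓝 0) := by
    have hGfin : ∀ᵐ r ∂μa, FunctionSpaces.Torus.eGradNormSq (u r) < ⊤ := by
      have h1 : ∀ᵐ r ∂μa, FunctionSpaces.Torus.eGradNormSq (u r) ^ (1 / 2 : ℝ) < ⊤ :=
        ae_lt_top' (hGm.pow_const _) hG.ne
      filter_upwards [h1] with r hr
      by_contra htop
      rw [not_lt, top_le_iff] at htop
      rw [htop, ENNReal.top_rpow_of_pos (by norm_num)] at hr
      exact lt_irrefl _ hr
    have hρle : ∀ᵐ r ∂μa, ∀ n, ρ n r ≤ Kρ r := by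
      refine ae_all_iff.2 fun n => ?_
      filter_upwards [ha.ae_memLp_two, hCa, ha.ae_memLp_two_velocity] with r hθ2 hθC hu2
      refine (IsWeakScalarTransportOn.lintegral_enorm_comm_le_eGradNormSq hθ2 hu2 (hε n) (hε' n)).trans ?_
      simp only [hKρ]
      gcongr
    filter_upwards [ha.ae_slice_integrable₁, ha.ae_isWeaklyDivFree, ha.ae_memLp_two, hCa, ha.ae_integrable_velocity,
      ha.ae_memLp_two_velocity, hGfin, hρle, hKρfin] with r h1 h2 h3 h4 h5 h6 h7 h8 h9
    refine ⟨⟨h1.1, h1.2.1, h1.2.2.1⟩, h2, h3, h4, h5, h6, h7, h8, h9, ?_⟩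
    exact FunctionSpaces.Torus.tendsto_eLpNorm_convolution_sub_self h3 hk0 hk1 hks
      (fun n => FunctionSpaces.Torus.continuous_kernel (hε n) (hε' n)) hε0
  have hP0 : Tendsto (fun n => ∫⁻ r, ρ n r ∂μa) atTop (𝓝 0) := by
    have hρ0 : ∀ᵐ r ∂μa, Tendsto (fun n => ρ n r) atTop (𝓝 0) := by
      filter_upwards [hgoodA] with r hr
      obtain ⟨⟨-, -, huθ⟩, hdiv, hθ2, -, hui, hu2, huG, -⟩ := hr
      exact tendsto_lintegral_enorm_comm hθ2 hui huθ hdiv (B := FunctionSpaces.Torus.eGradNormSq (u r) ^ (1 / 2 : ℝ))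
        (ENNReal.rpow_ne_top_of_nonneg (by norm_num) huG.ne) hε hε' hε0 fun n z hz =>
        IsWeakScalarTransportOn.eLpNorm_sub_translate_le_of_gradient_kernel_ne_zero hu2 (hε n) (hε' n) hz
    have := tendsto_lintegral_of_dominated_convergence' Kρ hρm (fun n => hgoodA.mono fun r hr => hr.2.2.2.2.2.2.2.1 n) hKρt
      (hρ0.mono fun r hr => by simpa using hr)
    simpa using this
  have hPt : ∀ n, ∫⁻ r, ρ n r ∂μa ≠ ⊤ := fun n =>
    ne_top_of_le_ne_top hKρt (lintegral_mono_ae (hgoodA.mono fun r hr => hr.2.2.2.2.2.2.2.1 n))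
  have hgoodA'' : ∀ᵐ τ ∂μ'', (Integrable (a (σ + τ)) volume ∧ AEStronglyMeasurable (u (σ + τ)) volume ∧
      Integrable (fun y => ‖u (σ + τ) y‖ * a (σ + τ) y) volume) ∧ FunctionSpaces.Torus.IsWeaklyDivFree (u (σ + τ)) ∧
      MemLp (a (σ + τ)) 2 volume ∧ eLpNorm (a (σ + τ)) 2 volume ≤ Ca ∧ Integrable (u (σ + τ)) volume ∧
      MemLp (u (σ + τ)) 2 volume ∧ FunctionSpaces.Torus.eGradNormSq (u (σ + τ)) < ⊤ ∧
      (∀ n, ρ n (σ + τ) ≤ Kρ (σ + τ)) ∧ Kρ (σ + τ) < ⊤ ∧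
      Tendsto (fun n => eLpNorm (a (σ + τ) ⋆ kk n - a (σ + τ)) 2 volume) atTop (𝓝 0) :=
    ae_restrict_Ioo_comp_add_left hgoodA hσ hσT''
  -- ### the `b`-side slice facts
  obtain ⟨Cb, hCb⟩ := hb.exists_eLpNorm_le
  have hgoodB'' : ∀ᵐ τ ∂μ'', (Integrable (b τ) volume ∧ AEStronglyMeasurable (u (σ + τ)) volume ∧
      Integrable (fun y => ‖u (σ + τ) y‖ * b τ y) volume) ∧ MemLp (b τ) 2 volume ∧ eLpNorm (b τ) 2 volume ≤ Cb ∧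
      (∀ᵐ x ∂(volume : Measure (UnitAddTorus d)), |b τ x| ≤ B) ∧ ∫ y, |b τ y| ≤ Cb := by
    refine ae_restrict_of_ae_restrict_of_subset hsub''b ?_
    filter_upwards [hb.ae_slice_integrable₁, hb.ae_memLp_two, hCb, hbB] with τ h1 h2 h3 h4
    exact ⟨h1, h2, h3, h4, integral_abs_le_of_eLpNorm_le h2 h3⟩
  -- ### the mollified identities along the kernel sequence
  have hE1 : ∀ᵐ τ ∂μ'', ∀ n, ∫ x, (a (σ + τ) ⋆ kk n) x * b τ x =
      ((∫ y, a₀ y * (g ⋆ kk n) y) + ∫ r in Ioc 0 σ, ((∫ y, a r y *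
          (⟪u r y, FunctionSpaces.Torus.gradient (g ⋆ kk n) y⟫_ℝ + κ * FunctionSpaces.Torus.laplacian (g ⋆ kk n) y)) +
          ∫ y, f y * (g ⋆ kk n) y)) +
      ∫ τ' in Ioc 0 τ, ((∫ y, b τ' y * ((∫ z, a (σ + τ') z *
          (-⟪u (σ + τ') z, FunctionSpaces.Torus.gradient (kk n) (y - z)⟫_ℝ + κ * FunctionSpaces.Torus.laplacian (kk n) (y - z))) +
          ∫ z, f z * kk n (y - z))) +
        ∫ y, b τ' y * (⟪u (σ + τ') y, FunctionSpaces.Torus.gradient (a (σ + τ') ⋆ kk n) y⟫_ℝ +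
          κ * FunctionSpaces.Torus.laplacian (a (σ + τ') ⋆ kk n) y)) :=
    ae_all_iff.2 fun n => ha.ae_pairing_molInt_eq ha₀i hf hσ hσT hTb hg hb (hkS n) (hkke n)
  -- ### convergence of the traces
  have hPlim : Tendsto (fun n => (∫ y, a₀ y * (g ⋆ kk n) y) + ∫ r in Ioc 0 σ, ((∫ y, a r y *
        (⟪u r y, FunctionSpaces.Torus.gradient (g ⋆ kk n) y⟫_ℝ + κ * FunctionSpaces.Torus.laplacian (g ⋆ kk n) y)) +
        ∫ y, f y * (g ⋆ kk n) y)) atTop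
      (𝓝 ((∫ y, a₀ y * g y) + ∫ r in Ioc 0 σ, ((∫ y, a r y *
        (⟪u r y, FunctionSpaces.Torus.gradient g y⟫_ℝ + κ * FunctionSpaces.Torus.laplacian g y)) +
        ∫ y, f y * g y))) := by
    have h := ha.tendsto_trace_convolution ha₀i hg hkS hk0 hk1 hks hε0 hσT
    simpa only using h
  -- ### measurability of the translated objects
  have hbm'' : AEStronglyMeasurable (uncurry b) (μ''.prod volume) :=
    hb.aestronglyMeasurable_uncurry.mono_measure (Measure.prod_mono hle''b le_rfl)
  have hcommm : ∀ n, AEStronglyMeasurable (uncurry fun τ x => ∫ y, a (σ + τ) y *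
      ⟪u (σ + τ) x - u (σ + τ) y, FunctionSpaces.Torus.gradient (kk n) (x - y)⟫_ℝ) (μ''.prod volume) := fun n =>
    aestronglyMeasurable_uncurry_comp_add_left (ha.aestronglyMeasurable_uncurry_comm₁ (hkS n)) hσ hσT''
  have hlapm : ∀ n, AEStronglyMeasurable (uncurry fun τ x => (a (σ + τ) ⋆ FunctionSpaces.Torus.laplacian (kk n)) x)
      (μ''.prod volume) := fun n =>
    aestronglyMeasurable_uncurry_comp_add_left (FunctionSpaces.Torus.aestronglyMeasurable_uncurry_convolution (lsmul ℝ ℝ)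
      ha.aestronglyMeasurable_uncurry (hkS n).laplacian.continuous) hσ hσT''
  have hρm'' : ∀ n, AEMeasurable (fun τ => ρ n (σ + τ)) μ'' := fun n => aemeasurable_comp_add_left (hρm n) hσ hσT''
  have hρint'' : ∀ n, ∫⁻ τ, ρ n (σ + τ) ∂μ'' ≤ ∫⁻ r, ρ n r ∂μa := fun n => setLIntegral_comp_add_left_le hσ hσT''
  have hρfin'' : ∀ n, ∫⁻ τ, ρ n (σ + τ) ∂μ'' ≠ ⊤ := fun n => ne_top_of_le_ne_top (hPt n) (hρint'' n)
  have heSGa : AEMeasurable (fun τ => eScalarGradNormSq (a (σ + τ))) μ'' :=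
    aemeasurable_comp_add_left ha.aemeasurable_eScalarGradNormSq hσ hσT''
  have heSGb : AEMeasurable (fun τ => eScalarGradNormSq (b τ)) μ'' := hb.aemeasurable_eScalarGradNormSq.mono_measure hle''b
  choose CΔ hCΔ using fun n => FunctionSpaces.Torus.exists_forall_norm_le_of_continuous (hkS n).laplacian.continuous
  choose Cg' hCg' using fun n => FunctionSpaces.Torus.exists_forall_norm_le_of_continuous (hkS n).gradient.continuous
  -- ### the good times
  filter_upwards [hE1, hgoodA'', hgoodB'', ae_restrict_mem measurableSet_Ioo] with τ hE1τ hA hB hτ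
  obtain ⟨⟨hai, -, -⟩, -, ha2, haC, -, -, -, -, -, halim⟩ := hA
  obtain ⟨⟨hbi, -, -⟩, hb2, hbC, hbBτ, hbL1⟩ := hB
  have hsubτ : Ioc 0 τ ⊆ Ioo 0 T'' := Ioc_subset_Ioo_right hτ.2
  set μτ : Measure ℝ := (volume : Measure ℝ).restrict (Ioc 0 τ) with hμτ
  have hleτ : μτ ≤ μ'' := Measure.restrict_mono_set _ hsubτ
  haveI : IsFiniteMeasure μτ := by rw [hμτ]; infer_instance
  have hB0 : ∀ᵐ x ∂(volume : Measure (UnitAddTorus d)), |b τ x| ≤ |B| := hbBτ.mono fun x hx => hx.trans (le_abs_self B)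
  -- names for the terms
  set E : ℕ → ℝ := fun n => ∫ x, (a (σ + τ) ⋆ kk n) x * b τ x with hE
  set Einf : ℝ := ∫ x, a (σ + τ) x * b τ x with hEinf
  set P : ℕ → ℝ := fun n => (∫ y, a₀ y * (g ⋆ kk n) y) + ∫ r in Ioc 0 σ, ((∫ y, a r y *
      (⟪u r y, FunctionSpaces.Torus.gradient (g ⋆ kk n) y⟫_ℝ + κ * FunctionSpaces.Torus.laplacian (g ⋆ kk n) y)) +
      ∫ y, f y * (g ⋆ kk n) y) with hP
  set Pinf : ℝ := (∫ y, a₀ y * g y) + ∫ r in Ioc 0 σ, ((∫ y, a r y *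
      (⟪u r y, FunctionSpaces.Torus.gradient g y⟫_ℝ + κ * FunctionSpaces.Torus.laplacian g y)) +
      ∫ y, f y * g y) with hPinf
  set In : ℕ → ℝ → ℝ := fun n s => (∫ y, b s y * ((∫ z, a (σ + s) z *
      (-⟪u (σ + s) z, FunctionSpaces.Torus.gradient (kk n) (y - z)⟫_ℝ + κ * FunctionSpaces.Torus.laplacian (kk n) (y - z))) +
      ∫ z, f z * kk n (y - z))) +
    ∫ y, b s y * (⟪u (σ + s) y, FunctionSpaces.Torus.gradient (a (σ + s) ⋆ kk n) y⟫_ℝ +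
      κ * FunctionSpaces.Torus.laplacian (a (σ + s) ⋆ kk n) y) with hIn
  set Cm : ℕ → ℝ → ℝ := fun n s => ∫ y, b s y * ∫ z, a (σ + s) z *
    ⟪u (σ + s) y - u (σ + s) z, FunctionSpaces.Torus.gradient (kk n) (y - z)⟫_ℝ with hCm
  set Vi : ℕ → ℝ → ℝ := fun n s => ∫ y, b s y * ((2 * κ) * FunctionSpaces.Torus.laplacian (a (σ + s) ⋆ kk n) y) with hVi
  set Sr : ℕ → ℝ → ℝ := fun n s => ∫ y, b s y * Sf n y with hSr
  have hId : ∀ n, E n = P n + ∫ s in Ioc 0 τ, In n s := fun n => hE1τ n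
  -- ### the slice algebra at good `s`
  have hslice : ∀ n, ∀ᵐ s ∂μτ, In n s = Cm n s + Vi n s + Sr n s ∧
      |Cm n s| ≤ |B| * (ρ n (σ + s)).toReal ∧ |Sr n s| ≤ Cf * Cb ∧ |Vi n s| ≤ 2 * |κ| * (CΔ n * Ca) * Cb ∧
      ‖Vi n s‖ₑ ≤ ENNReal.ofReal (2 * κ) * (eScalarGradNormSq (b s) ^ (1 / 2 : ℝ) * eScalarGradNormSq (a (σ + s)) ^ (1 / 2 : ℝ)) ∧
      Vi n s = ∫ y, b s y * ((2 * κ) * (a (σ + s) ⋆ FunctionSpaces.Torus.laplacian (kk n)) y) := by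
    intro n
    filter_upwards [ae_restrict_of_ae_restrict_of_subset hsubτ hgoodA'', ae_restrict_of_ae_restrict_of_subset hsubτ hgoodB'']
      with s hsA hsB
    obtain ⟨⟨hai', hau', hauθ'⟩, -, ha2', haC', hui', -, -, hρle', hKfin', -⟩ := hsA
    obtain ⟨⟨hbi', hbu', hbuθ'⟩, hb2', hbC', hbB', hbL1'⟩ := hsB
    have hB' : ∀ᵐ y ∂(volume : Measure (UnitAddTorus d)), |b s y| ≤ |B| := hbB'.mono fun y hy => hy.trans (le_abs_self B)
    -- the objects at this slice
    set M : UnitAddTorus d → ℝ := a (σ + s) ⋆ kk n with hM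
    have hMs : FunctionSpaces.Torus.IsSmooth M := FunctionSpaces.Torus.isSmooth_convolution hai' (hkS n)
    set comm : UnitAddTorus d → ℝ := fun y => ∫ z, a (σ + s) z *
      ⟪u (σ + s) y - u (σ + s) z, FunctionSpaces.Torus.gradient (kk n) (y - z)⟫_ℝ with hcomm
    set flux : UnitAddTorus d → ℝ := fun y => ∫ z, a (σ + s) z *
      (-⟪u (σ + s) z, FunctionSpaces.Torus.gradient (kk n) (y - z)⟫_ℝ + κ * FunctionSpaces.Torus.laplacian (kk n) (y - z)) with hflux
    have hfluxeq : ∀ y, flux y = comm y - ⟪u (σ + s) y, FunctionSpaces.Torus.gradient M y⟫_ℝ +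
        κ * FunctionSpaces.Torus.laplacian M y := fun y =>
      fluxIntegral_eq_comm_sub_add_of_integrable hai' hau' hauθ' (hkS n) κ y
    have hfluxc : Continuous flux := continuous_fluxIntegral hai' hau' hauθ' (hkS n) κ
    -- bounds on the derivatives of `M`
    have hCa1 : ∫ y, ‖a (σ + s) y‖ ≤ Ca := le_trans (le_of_eq (integral_congr_ae (Eventually.of_forall fun y => Real.norm_eq_abs _)))
      (integral_abs_le_of_eLpNorm_le ha2' haC')
    have hgradM : ∀ y, ‖FunctionSpaces.Torus.gradient M y‖ ≤ Cg' n * Ca := fun y => by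
      rw [hM, FunctionSpaces.Torus.gradient_convolution hai' (hkS n) y]
      exact (FunctionSpaces.Torus.norm_convolution_le hai' (hCg' n) y).trans
        (mul_le_mul_of_nonneg_left hCa1 ((norm_nonneg _).trans (hCg' n 0)))
    have hlapM : ∀ y, ‖FunctionSpaces.Torus.laplacian M y‖ ≤ CΔ n * Ca := fun y => by
      rw [hM, FunctionSpaces.Torus.laplacian_convolution hai' (hkS n) y]
      exact (FunctionSpaces.Torus.norm_convolution_le hai' (hCΔ n) y).trans
        (mul_le_mul_of_nonneg_left hCa1 ((norm_nonneg _).trans (hCΔ n 0)))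
    have hbabs : Integrable (fun y => ‖u (σ + s) y‖ * |b s y|) volume := by
      refine hbuθ'.norm.congr (Eventually.of_forall fun y => ?_); simp [Real.norm_eq_abs]
    -- integrability of the pieces
    obtain ⟨Cfl, hCfl⟩ := FunctionSpaces.Torus.exists_forall_norm_le_of_continuous hfluxc
    have i1 : Integrable (fun y => b s y * (flux y + Sf n y)) volume :=
      hbi'.mul_bdd (c := Cfl + Cf) (hfluxc.add (hSf_cont n)).aestronglyMeasurable
        (Eventually.of_forall fun y => (norm_add_le _ _).trans (add_le_add (hCfl y) (by rw [Real.norm_eq_abs]; exact hSf_le n y)))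
    have i2 : Integrable (fun y => b s y * (⟪u (σ + s) y, FunctionSpaces.Torus.gradient M y⟫_ℝ +
        κ * FunctionSpaces.Torus.laplacian M y)) volume := by
      refine Integrable.mono' ((hbabs.const_mul (Cg' n * Ca)).add (hbi'.abs.const_mul (|κ| * (CΔ n * Ca))))
        (hbi'.aestronglyMeasurable.mul ((hbu'.inner hMs.gradient.continuous.aestronglyMeasurable).add
          (aestronglyMeasurable_const.mul hMs.laplacian.continuous.aestronglyMeasurable))) (Eventually.of_forall fun y => ?_)
      rw [norm_mul, Real.norm_eq_abs, Real.norm_eq_abs]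
      have h1 : |⟪u (σ + s) y, FunctionSpaces.Torus.gradient M y⟫_ℝ| ≤ ‖u (σ + s) y‖ * (Cg' n * Ca) :=
        (abs_real_inner_le_norm _ _).trans (mul_le_mul_of_nonneg_left (hgradM y) (norm_nonneg _))
      have h2 : |κ * FunctionSpaces.Torus.laplacian M y| ≤ |κ| * (CΔ n * Ca) := by
        rw [abs_mul]; exact mul_le_mul_of_nonneg_left (by rw [← Real.norm_eq_abs]; exact hlapM y) (abs_nonneg _)
      calc |b s y| * |⟪u (σ + s) y, FunctionSpaces.Torus.gradient M y⟫_ℝ + κ * FunctionSpaces.Torus.laplacian M y|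
          ≤ |b s y| * (‖u (σ + s) y‖ * (Cg' n * Ca) + |κ| * (CΔ n * Ca)) :=
            mul_le_mul_of_nonneg_left ((abs_add_le _ _).trans (add_le_add h1 h2)) (abs_nonneg _)
        _ = Cg' n * Ca * (‖u (σ + s) y‖ * |b s y|) + |κ| * (CΔ n * Ca) * |b s y| := by ring
    have iS : Integrable (fun y => b s y * Sf n y) volume :=
      hbi'.mul_bdd (c := Cf) (hSf_cont n).aestronglyMeasurable (Eventually.of_forall fun y => by rw [Real.norm_eq_abs]; exact hSf_le n y)
    have iV : Integrable (fun y => b s y * ((2 * κ) * FunctionSpaces.Torus.laplacian M y)) volume :=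
      hbi'.mul_bdd (c := |2 * κ| * (CΔ n * Ca)) (continuous_const.mul hMs.laplacian.continuous).aestronglyMeasurable
        (Eventually.of_forall fun y => by rw [norm_mul, Real.norm_eq_abs]; exact mul_le_mul_of_nonneg_left (hlapM y) (abs_nonneg _))
    have iC : Integrable (fun y => b s y * comm y) volume := by
      have e : (fun y => b s y * comm y) = fun y => b s y * (flux y + Sf n y) +
          b s y * (⟪u (σ + s) y, FunctionSpaces.Torus.gradient M y⟫_ℝ + κ * FunctionSpaces.Torus.laplacian M y) -
          b s y * Sf n y - b s y * ((2 * κ) * FunctionSpaces.Torus.laplacian M y) := by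
        funext y; rw [hfluxeq y]; ring
      rw [e]; exact ((i1.add i2).sub iS).sub iV
    -- the identity
    have hIn_eq : In n s = Cm n s + Vi n s + Sr n s := by
      have e1 : In n s = (∫ y, b s y * (flux y + Sf n y)) + ∫ y, b s y *
          (⟪u (σ + s) y, FunctionSpaces.Torus.gradient M y⟫_ℝ + κ * FunctionSpaces.Torus.laplacian M y) := rfl
      rw [e1, ← integral_add i1 i2]
      have e2 : (fun y => b s y * (flux y + Sf n y) + b s y *
          (⟪u (σ + s) y, FunctionSpaces.Torus.gradient M y⟫_ℝ + κ * FunctionSpaces.Torus.laplacian M y)) =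
          fun y => b s y * comm y + b s y * ((2 * κ) * FunctionSpaces.Torus.laplacian M y) + b s y * Sf n y := by
        funext y; rw [hfluxeq y]; ring
      have iCV : Integrable (fun y => b s y * comm y + b s y * ((2 * κ) * FunctionSpaces.Torus.laplacian M y)) volume :=
        iC.add iV
      rw [e2, integral_add iCV iS, integral_add iC iV]
    -- the commutator bound
    have hcomm_meas : AEStronglyMeasurable comm volume := by
      have hKc : Continuous fun p : UnitAddTorus d × UnitAddTorus d => FunctionSpaces.Torus.gradient (kk n) (p.1 - p.2) :=
        (hkS n).gradient.continuous.comp (continuous_fst.sub continuous_snd)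
      have hP : AEStronglyMeasurable (Function.uncurry fun (y z : UnitAddTorus d) => a (σ + s) z * ⟪u (σ + s) y - u (σ + s) z,
          FunctionSpaces.Torus.gradient (kk n) (y - z)⟫_ℝ) ((volume : Measure (UnitAddTorus d)).prod volume) :=
        (hai'.aestronglyMeasurable.comp_snd).mul (((hau'.comp_fst).sub (hau'.comp_snd)).inner hKc.aestronglyMeasurable)
      exact hP.integral_prod_right'
    have hCm_le : |Cm n s| ≤ |B| * (ρ n (σ + s)).toReal := by
      have e : (ρ n (σ + s)).toReal = ∫ y, ‖comm y‖ := by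
        rw [integral_norm_eq_lintegral_enorm hcomm_meas]
      have iComm : Integrable comm volume := by
        have e' : comm = fun y => flux y + ⟪u (σ + s) y, FunctionSpaces.Torus.gradient M y⟫_ℝ -
            κ * FunctionSpaces.Torus.laplacian M y := by
          funext y; rw [hfluxeq y]; ring
        rw [e']
        refine (hfluxc.integrable_unitAddTorus.add ?_).sub (continuous_const.mul hMs.laplacian.continuous).integrable_unitAddTorus
        refine Integrable.mono' (hui'.norm.mul_const (Cg' n * Ca))
          (hau'.inner hMs.gradient.continuous.aestronglyMeasurable) (Eventually.of_forall fun y => ?_)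
        rw [Real.norm_eq_abs]
        exact (abs_real_inner_le_norm _ _).trans (mul_le_mul_of_nonneg_left (hgradM y) (norm_nonneg _))
      rw [e]
      calc |Cm n s| ≤ ∫ y, |b s y * comm y| := abs_integral_le_integral_abs
        _ ≤ ∫ y, |B| * ‖comm y‖ := by
            refine integral_mono_ae iC.abs (iComm.norm.const_mul |B|) ?_
            filter_upwards [hB'] with y hy
            rw [abs_mul, Real.norm_eq_abs]
            exact mul_le_mul_of_nonneg_right hy (abs_nonneg _)
        _ = |B| * ∫ y, ‖comm y‖ := MeasureTheory.integral_const_mul _ _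
    -- the source bound
    have hSr_le : |Sr n s| ≤ Cf * Cb := by
      calc |Sr n s| ≤ ∫ y, |b s y * Sf n y| := abs_integral_le_integral_abs
        _ ≤ ∫ y, Cf * |b s y| := by
            refine integral_mono_of_nonneg (Eventually.of_forall fun y => abs_nonneg _) (hbi'.abs.const_mul _)
              (Eventually.of_forall fun y => ?_)
            dsimp only
            rw [abs_mul, mul_comm]
            exact mul_le_mul_of_nonneg_right (hSf_le n y) (abs_nonneg _)
        _ = Cf * ∫ y, |b s y| := MeasureTheory.integral_const_mul _ _
        _ ≤ Cf * Cb := mul_le_mul_of_nonneg_left hbL1' hCf0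
    -- the viscous term: real bound, spectral bound, measurable form
    have hVi_real : |Vi n s| ≤ 2 * |κ| * (CΔ n * Ca) * Cb := by
      calc |Vi n s| ≤ ∫ y, |b s y * ((2 * κ) * FunctionSpaces.Torus.laplacian M y)| := abs_integral_le_integral_abs
        _ ≤ ∫ y, (2 * |κ| * (CΔ n * Ca)) * |b s y| := by
            refine integral_mono_of_nonneg (Eventually.of_forall fun y => abs_nonneg _) (hbi'.abs.const_mul _)
              (Eventually.of_forall fun y => ?_)
            dsimp only
            rw [abs_mul, abs_mul, abs_mul, abs_two, mul_comm]
            have := hlapM y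
            rw [Real.norm_eq_abs] at this
            gcongr
        _ = (2 * |κ| * (CΔ n * Ca)) * ∫ y, |b s y| := MeasureTheory.integral_const_mul _ _
        _ ≤ (2 * |κ| * (CΔ n * Ca)) * Cb := by
            have h0 : 0 ≤ 2 * |κ| * (CΔ n * Ca) := by
              have := (norm_nonneg _).trans (hlapM 0); positivity
            exact mul_le_mul_of_nonneg_left hbL1' h0
    have hVi_enorm : ‖Vi n s‖ₑ ≤ ENNReal.ofReal (2 * κ) *
        (eScalarGradNormSq (b s) ^ (1 / 2 : ℝ) * eScalarGradNormSq (a (σ + s)) ^ (1 / 2 : ℝ)) := by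
      have e : Vi n s = (2 * κ) * ∫ y, b s y * FunctionSpaces.Torus.laplacian M y := by
        simp only [hVi]
        rw [← MeasureTheory.integral_const_mul]
        exact integral_congr_ae (Eventually.of_forall fun y => by ring)
      rw [e, enorm_mul, Real.enorm_eq_ofReal (by positivity)]
      refine mul_le_mul' le_rfl ((enorm_integral_mul_laplacian_le hb2' hMs).trans ?_)
      refine mul_le_mul' le_rfl (ENNReal.rpow_le_rpow ?_ (by norm_num))
      exact eScalarGradNormSq_convolution_le hai' (hkS n).continuous (hk0 n) (hk1 n)
    have hVi_meas : Vi n s = ∫ y, b s y * ((2 * κ) * (a (σ + s) ⋆ FunctionSpaces.Torus.laplacian (kk n)) y) := by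
      simp only [hVi]
      refine integral_congr_ae (Eventually.of_forall fun y => ?_)
      dsimp only
      rw [FunctionSpaces.Torus.laplacian_convolution hai' (hkS n) y]
    exact ⟨hIn_eq, hCm_le, hSr_le, hVi_real, hVi_enorm, hVi_meas⟩
  -- ### integrability of the pieces on `(0, τ]`
  have hCmi : ∀ n, Integrable (Cm n) μτ := by
    intro n
    have hm : AEStronglyMeasurable (Cm n) μτ :=
      ((hbm''.mul (hcommm n)).integral_prod_right').mono_measure hleτ
    refine Integrable.mono' (((integrable_toReal_of_lintegral_ne_top (hρm'' n) (hρfin'' n)).const_mul |B|).mono_measure hleτ)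
      hm ((hslice n).mono fun s hs => ?_)
    rw [Real.norm_eq_abs]; exact hs.2.1
  have hSri : ∀ n, Integrable (Sr n) μτ := by
    intro n
    have hm : AEStronglyMeasurable (Sr n) μτ :=
      ((hbm''.mul ((hSf_cont n).comp continuous_snd).aestronglyMeasurable).integral_prod_right').mono_measure hleτ
    refine Integrable.mono' (integrable_const (Cf * Cb)) hm ((hslice n).mono fun s hs => ?_)
    rw [Real.norm_eq_abs]; exact hs.2.2.1
  have hVii : ∀ n, Integrable (Vi n) μτ := by
    intro n
    have hm' : AEStronglyMeasurable (fun s => ∫ y, b s y * ((2 * κ) * (a (σ + s) ⋆ FunctionSpaces.Torus.laplacian (kk n)) y)) μτ :=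
      ((hbm''.mul (aestronglyMeasurable_const.mul (hlapm n))).integral_prod_right').mono_measure hleτ
    have hm : AEStronglyMeasurable (Vi n) μτ := hm'.congr ((hslice n).mono fun s hs => hs.2.2.2.2.2.symm)
    refine Integrable.mono' (integrable_const (2 * |κ| * (CΔ n * Ca) * Cb)) hm ((hslice n).mono fun s hs => ?_)
    rw [Real.norm_eq_abs]; exact hs.2.2.2.1
  have hsplit : ∀ n, ∫ s in Ioc 0 τ, In n s = (∫ s in Ioc 0 τ, Cm n s) + (∫ s in Ioc 0 τ, Vi n s) + ∫ s in Ioc 0 τ, Sr n s := by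
    intro n
    have iCV : Integrable (fun s => Cm n s + Vi n s) μτ := (hCmi n).add (hVii n)
    rw [integral_congr_ae ((hslice n).mono fun s hs => hs.1), integral_add iCV (hSri n), integral_add (hCmi n) (hVii n)]
  -- ### the limits
  -- the left-hand side
  have hElim : Tendsto E atTop (𝓝 Einf) := by
    have hB0' : 0 ≤ |B| := abs_nonneg B
    have i0 : Integrable (fun x => a (σ + τ) x * b τ x) volume := ha2.integrable_mul hb2
    have im : ∀ n, Integrable (fun x => (a (σ + τ) ⋆ kk n) x * b τ x) volume := by
      intro n
      obtain ⟨CM, hCM⟩ := FunctionSpaces.Torus.exists_forall_norm_le_of_continuous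
        (FunctionSpaces.Torus.continuous_convolution hai (hkS n).continuous)
      exact hbi.bdd_mul (c := CM) (FunctionSpaces.Torus.continuous_convolution hai (hkS n).continuous).aestronglyMeasurable
        (Eventually.of_forall hCM)
    have hbound : ∀ n, |E n - Einf| ≤ |B| * (eLpNorm (a (σ + τ) ⋆ kk n - a (σ + τ)) 2 volume).toReal := by
      intro n
      have hmem : MemLp (a (σ + τ) ⋆ kk n - a (σ + τ)) 2 volume :=
        ((FunctionSpaces.Torus.isSmooth_convolution hai (hkS n)).memLp 2).sub ha2
      have hfin : eLpNorm (a (σ + τ) ⋆ kk n - a (σ + τ)) 2 volume ≠ ⊤ := hmem.eLpNorm_ne_top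
      have hL1 : ∫ x, |(a (σ + τ) ⋆ kk n - a (σ + τ)) x| ≤ (eLpNorm (a (σ + τ) ⋆ kk n - a (σ + τ)) 2 volume).toReal := by
        have := integral_abs_le_of_eLpNorm_le hmem (C := (eLpNorm (a (σ + τ) ⋆ kk n - a (σ + τ)) 2 volume).toNNReal)
          (le_of_eq (ENNReal.coe_toNNReal hfin).symm)
        simpa only [ENNReal.coe_toNNReal_eq_toReal] using this
      simp only [hE, hEinf]
      rw [← integral_sub (im n) i0]
      calc |∫ x, ((a (σ + τ) ⋆ kk n) x * b τ x - a (σ + τ) x * b τ x)|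
          ≤ ∫ x, |(a (σ + τ) ⋆ kk n) x * b τ x - a (σ + τ) x * b τ x| := abs_integral_le_integral_abs
        _ ≤ ∫ x, |B| * |(a (σ + τ) ⋆ kk n - a (σ + τ)) x| := by
            refine integral_mono_ae ((im n).sub i0).abs ((hmem.integrable one_le_two).abs.const_mul |B|) ?_
            filter_upwards [hB0] with x hx
            rw [← sub_mul, abs_mul, Pi.sub_apply, mul_comm]
            exact mul_le_mul_of_nonneg_right hx (abs_nonneg _)
        _ = |B| * ∫ x, |(a (σ + τ) ⋆ kk n - a (σ + τ)) x| := MeasureTheory.integral_const_mul _ _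
        _ ≤ |B| * (eLpNorm (a (σ + τ) ⋆ kk n - a (σ + τ)) 2 volume).toReal := mul_le_mul_of_nonneg_left hL1 hB0'
    have h0 : Tendsto (fun n => |B| * (eLpNorm (a (σ + τ) ⋆ kk n - a (σ + τ)) 2 volume).toReal) atTop (𝓝 0) := by
      have h1 := (ENNReal.tendsto_toReal ENNReal.zero_ne_top).comp halim
      rw [ENNReal.toReal_zero] at h1
      simpa using h1.const_mul |B|
    have h2 : Tendsto (fun n => E n - Einf) atTop (𝓝 0) :=
      squeeze_zero_norm (fun n => by rw [Real.norm_eq_abs]; exact hbound n) h0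
    exact tendsto_sub_nhds_zero_iff.1 h2
  -- the source term
  have hSrlim : Tendsto (fun n => ∫ s in Ioc 0 τ, Sr n s) atTop (𝓝 (∫ s in Ioc 0 τ, ∫ y, b s y * f y)) := by
    refine tendsto_integral_of_dominated_convergence (fun _ => Cf * Cb) (fun n => (hSri n).aestronglyMeasurable)
      (integrable_const _) (fun n => (hslice n).mono fun s hs => by rw [Real.norm_eq_abs]; exact hs.2.2.1) ?_
    filter_upwards [ae_restrict_of_ae_restrict_of_subset hsubτ hgoodB''] with s hsB
    obtain ⟨⟨hbi', -, -⟩, -⟩ := hsB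
    exact tendsto_integral_of_dominated_convergence (fun y => Cf * |b s y|)
      (fun n => hbi'.aestronglyMeasurable.mul (hSf_cont n).aestronglyMeasurable) (hbi'.abs.const_mul Cf)
      (fun n => Eventually.of_forall fun y => by
        rw [norm_mul, Real.norm_eq_abs, Real.norm_eq_abs, mul_comm]
        exact mul_le_mul_of_nonneg_right (hSf_le n y) (abs_nonneg _))
      (Eventually.of_forall fun y => (hSf_pt y).const_mul (b s y))
  -- the commutator term
  have hCmlim : Tendsto (fun n => ∫ s in Ioc 0 τ, Cm n s) atTop (𝓝 0) := by
    have hbound : ∀ n, |∫ s in Ioc 0 τ, Cm n s| ≤ |B| * (∫⁻ r, ρ n r ∂μa).toReal := by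
      intro n
      have hρi := integrable_toReal_of_lintegral_ne_top (hρm'' n) (hρfin'' n)
      have h1 : ∫ s, (ρ n (σ + s)).toReal ∂μτ ≤ (∫⁻ r, ρ n r ∂μa).toReal := by
        have h2 : ∫ s, (ρ n (σ + s)).toReal ∂μτ ≤ ∫ s, (ρ n (σ + s)).toReal ∂μ'' :=
          integral_mono_measure hleτ (Eventually.of_forall fun s => ENNReal.toReal_nonneg) hρi
        have h3 : ∫ s, (ρ n (σ + s)).toReal ∂μ'' = (∫⁻ s, ρ n (σ + s) ∂μ'').toReal :=
          integral_toReal (hρm'' n) (ae_lt_top' (hρm'' n) (hρfin'' n))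
        exact h2.trans (h3.le.trans (ENNReal.toReal_mono (hPt n) (hρint'' n)))
      calc |∫ s in Ioc 0 τ, Cm n s| ≤ ∫ s in Ioc 0 τ, |Cm n s| := abs_integral_le_integral_abs
        _ ≤ ∫ s in Ioc 0 τ, |B| * (ρ n (σ + s)).toReal :=
            integral_mono_ae (hCmi n).abs ((hρi.const_mul |B|).mono_measure hleτ) ((hslice n).mono fun s hs => hs.2.1)
        _ = |B| * ∫ s in Ioc 0 τ, (ρ n (σ + s)).toReal := MeasureTheory.integral_const_mul _ _
        _ ≤ |B| * (∫⁻ r, ρ n r ∂μa).toReal := mul_le_mul_of_nonneg_left h1 (abs_nonneg B)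
    have h0 : Tendsto (fun n => |B| * (∫⁻ r, ρ n r ∂μa).toReal) atTop (𝓝 0) := by
      have h1 := (ENNReal.tendsto_toReal ENNReal.zero_ne_top).comp hP0
      rw [ENNReal.toReal_zero] at h1
      simpa using h1.const_mul |B|
    exact squeeze_zero_norm (fun n => by rw [Real.norm_eq_abs]; exact hbound n) h0
  -- the viscous term
  have hVibd : ∀ n, ‖∫ s in Ioc 0 τ, Vi n s‖ₑ ≤
      2 * eScalarDissipation κ a σ (σ + τ) ^ (1 / 2 : ℝ) * eScalarDissipation κ b 0 τ ^ (1 / 2 : ℝ) := by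
    intro n
    set F : ℝ → ℝ≥0∞ := fun s => eScalarGradNormSq (b s) ^ (1 / 2 : ℝ) with hF
    set G' : ℝ → ℝ≥0∞ := fun s => eScalarGradNormSq (a (σ + s)) ^ (1 / 2 : ℝ) with hG'
    have hFm : AEMeasurable F μτ := (heSGb.mono_measure hleτ).pow_const _
    have hGm' : AEMeasurable G' μτ := (heSGa.mono_measure hleτ).pow_const _
    have hH := ENNReal.lintegral_mul_le_Lp_mul_Lq μτ Real.HolderConjugate.two_two hFm hGm'
    have eF : ∫⁻ s, F s ^ (2 : ℝ) ∂μτ = ∫⁻ s in Ioo 0 τ, eScalarGradNormSq (b s) := by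
      rw [hμτ, setLIntegral_congr Ioo_ae_eq_Ioc.symm]
      refine lintegral_congr fun s => ?_
      simp only [hF]
      rw [← ENNReal.rpow_mul]; norm_num
    have eG : ∫⁻ s, G' s ^ (2 : ℝ) ∂μτ = ∫⁻ s in Ioo σ (σ + τ), eScalarGradNormSq (a s) := by
      rw [hμτ, setLIntegral_congr Ioo_ae_eq_Ioc.symm]
      have e1 : ∫⁻ s in Ioo 0 τ, G' s ^ (2 : ℝ) = ∫⁻ s in Ioo 0 τ, eScalarGradNormSq (a (s + σ)) := by
        refine lintegral_congr fun s => ?_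
        simp only [hG']
        rw [← ENNReal.rpow_mul, add_comm s σ]; norm_num
      rw [e1, setLIntegral_Ioo_comp_add_right (fun r => eScalarGradNormSq (a r)) 0 τ σ, zero_add, add_comm τ σ]
    have hk2 : ENNReal.ofReal κ ^ (1 / 2 : ℝ) * ENNReal.ofReal κ ^ (1 / 2 : ℝ) = ENNReal.ofReal κ := by
      rw [← ENNReal.rpow_add_of_nonneg _ _ (by norm_num) (by norm_num)]; norm_num
    calc ‖∫ s in Ioc 0 τ, Vi n s‖ₑ ≤ ∫⁻ s, ‖Vi n s‖ₑ ∂μτ := enorm_integral_le_lintegral_enorm _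
      _ ≤ ∫⁻ s, ENNReal.ofReal (2 * κ) * (F s * G' s) ∂μτ := lintegral_mono_ae ((hslice n).mono fun s hs => hs.2.2.2.2.1)
      _ = ENNReal.ofReal (2 * κ) * ∫⁻ s, F s * G' s ∂μτ := by
          rw [lintegral_const_mul'' _ (show AEMeasurable (fun s => F s * G' s) μτ from hFm.mul hGm')]
      _ ≤ ENNReal.ofReal (2 * κ) * ((∫⁻ s, F s ^ (2 : ℝ) ∂μτ) ^ (1 / (2 : ℝ)) * (∫⁻ s, G' s ^ (2 : ℝ) ∂μτ) ^ (1 / (2 : ℝ))) :=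
          mul_le_mul' le_rfl hH
      _ = 2 * eScalarDissipation κ a σ (σ + τ) ^ (1 / 2 : ℝ) * eScalarDissipation κ b 0 τ ^ (1 / 2 : ℝ) := by
          rw [eF, eG, eScalarDissipation, eScalarDissipation, ENNReal.mul_rpow_of_nonneg _ _ (by norm_num : (0 : ℝ) ≤ 1 / 2),
            ENNReal.mul_rpow_of_nonneg _ _ (by norm_num : (0 : ℝ) ≤ 1 / 2), ENNReal.ofReal_mul (by norm_num : (0 : ℝ) ≤ 2),
            ENNReal.ofReal_ofNat]
          have e3 : (2 : ℝ≥0∞) * (ENNReal.ofReal κ ^ (1 / 2 : ℝ) * (∫⁻ s in Ioo σ (σ + τ), eScalarGradNormSq (a s)) ^ (1 / 2 : ℝ)) *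
              (ENNReal.ofReal κ ^ (1 / 2 : ℝ) * (∫⁻ s in Ioo 0 τ, eScalarGradNormSq (b s)) ^ (1 / 2 : ℝ)) =
              2 * (ENNReal.ofReal κ ^ (1 / 2 : ℝ) * ENNReal.ofReal κ ^ (1 / 2 : ℝ)) *
                ((∫⁻ s in Ioo 0 τ, eScalarGradNormSq (b s)) ^ (1 / 2 : ℝ) *
                  (∫⁻ s in Ioo σ (σ + τ), eScalarGradNormSq (a s)) ^ (1 / 2 : ℝ)) := by ring
          rw [e3, hk2]
  -- ### conclusion
  have hX : ∀ n, E n - P n - (∫ s in Ioc 0 τ, Sr n s) - (∫ s in Ioc 0 τ, Cm n s) = ∫ s in Ioc 0 τ, Vi n s := by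
    intro n
    rw [hId n, hsplit n]
    ring
  have hXlim : Tendsto (fun n => E n - P n - (∫ s in Ioc 0 τ, Sr n s) - (∫ s in Ioc 0 τ, Cm n s)) atTop
      (𝓝 (Einf - Pinf - (∫ s in Ioc 0 τ, ∫ y, b s y * f y) - 0)) := ((hElim.sub hPlim).sub hSrlim).sub hCmlim
  rw [sub_zero] at hXlim
  have hle : ∀ n, ENNReal.ofReal |E n - P n - (∫ s in Ioc 0 τ, Sr n s) - (∫ s in Ioc 0 τ, Cm n s)| ≤
      2 * eScalarDissipation κ a σ (σ + τ) ^ (1 / 2 : ℝ) * eScalarDissipation κ b 0 τ ^ (1 / 2 : ℝ) := fun n => by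
    rw [hX n, ← Real.enorm_eq_ofReal_abs]
    exact hVibd n
  exact le_of_tendsto' (ENNReal.tendsto_ofReal hXlim.abs) hle




end IsWeakScalarTransportForcedOn

end Torus

end Literature.Analysis.FluidPDE
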